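import Mathlib
import Summits.NavierStokesRegularity.FluidComputer.AbcClassIIEigenpairOfBases
import Summits.NavierStokesRegularity.FluidComputer.BorderedEigenpairApproxInverse

/-!
# GROUP-B END-TO-END ON THE MODEL, CLASS II, IN ARBITRARY ORBIT BASES — from the certifiers' FLOAT-INVERSE
# DATA (profile-cert-3 g7, 2026-08-27)
HONEST FRAMING (D-0035/D-0074): not a claim about Navier–Stokes blow-up. WHAT THIS IS NOT: not NS evidence;
MODEL lane (NS linearised about the forced ABC flow `abcFlow 1 1 1`, class II); no certificate, number or
census word moves. `AbcClassIIEigenpair.isLinNSEigenvalue_near_of_nested_certificate_of_bases` with the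
posited EXACT bordered left inverse + bounds + `Binv`-shell number REPLACED by the float-inverse data the
3-B-nested certifiers print (θ ≥ ‖I − X̃Â₀‖₂, nX, yB, nB, yC, nC, xmu, ygB, MU2X; α = nX/(1−θ), δ = αθ,
β_B = yB + nB δ, β_C' = yC + nC δ + nt (xmu + δ), g_B = ygB + nB δ, MU2 = MU2X − nB nC δ = cert3.py run_row
7–12; impl-1 (c4)/(N3)–(N5); impl-2 i3cert) via `BorderedEigenpairApproxInverse.exists_borderedInverse_of_approx`,
for an ARBITRARY family of real orthonormal orbit bases (first-order matrix `am`, instab4 g7): this is the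
row-level statement a certifier audit discharges in the certifier's OWN basis from its OWN printed numbers.
Conclusion verbatim. Mathlib + the two files named; no new definitions. bears_on LADDER-NS N5 / Z4-a(1).
-/

noncomputable section

open scoped BigOperators ComplexConjugate InnerProductSpace
open Finset

namespace Summit.NavierStokesRegularity.FluidComputer.AbcClassIIEigenpair

open Literature.Analysis.FunctionSpaces Literature.Analysis.FunctionSpaces.Torus
open Literature.Analysis.FluidPDE
open Summit.NavierStokesRegularity.FluidComputer.AbcClassII

section OfBases

variable (e : ∀ O : Orbit, OrthonormalBasis (Fin (odim O)) ℝ (realSpace O.1))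
variable (bf : Idx → Fam)
variable (hbf : ∀ i : Idx, bf i = extend i.1.1 ((e i.1 i.2 : realSpace i.1.1) : EuclideanSpace ℂ (↥i.1.1 × Fin 3)))
variable (am : Idx → Idx → ℝ)
variable (ham : ∀ i j : Idx, am i j =
  (∑ k ∈ i.1.1, (inner ℂ (bf i k) (Torus.lerayCoeff k (crossForm 1 1 1 (bf j) k)) : ℂ)).re)

include hbf ham in

/-- **GROUP-B END-TO-END ON THE MODEL (class II), arbitrary orbit bases, from float-inverse data.** -/
theorem isLinNSEigenvalue_near_of_nested_certificate_of_approx_inverse_of_bases {R : ℝ} (hR : 1 ≤ R)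
    (K Kv : ℕ) (lt : ℂ)
    (vt : Idx → ℂ) (hvt0 : ∀ i, i ∉ cubeIdx Kv → vt i = 0)
    {r₀ nt : ℝ} (hr₀ : 0 ≤ r₀) (hnt : 0 ≤ nt)
    (hres : ∑ i ∈ cubeIdx Kv ∪ (cubeIdx Kv).biUnion nbrIdx,
      ‖(if i ∈ cubeIdx Kv then (lt - ((-(onormSq i.1 / R) : ℝ) : ℂ)) * vt i else 0) -
        ∑ j ∈ cubeIdx Kv, ((am i j : ℝ) : ℂ) * vt j‖ ^ 2 ≤ r₀ ^ 2)
    (hntb : ∑ i ∈ cubeIdx Kv \ cubeIdx K, ‖vt i‖ ^ 2 ≤ nt ^ 2)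
    -- the float inverse of the bordered Galerkin matrix and its certified data
    (X : ((↥(cubeIdx K) → ℂ) × ℂ) →ₗ[ℂ] ((↥(cubeIdx K) → ℂ) × ℂ))
    {θ nX yB nB yC nC xmu ygB MU2X : ℝ}
    (hθ0 : 0 ≤ θ) (hθ1 : θ < 1) (hnX0 : 0 ≤ nX) (hyB0 : 0 ≤ yB) (hnB0 : 0 ≤ nB)
    (hyC0 : 0 ≤ yC) (hnC0 : 0 ≤ nC) (hxmu0 : 0 ≤ xmu) (hygB0 : 0 ≤ ygB)
    (hθ : ∀ (c : ↥(cubeIdx K) → ℂ) (m : ℂ),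
      ∑ j : ↥(cubeIdx K), ‖c j - (X (fun i : ↥(cubeIdx K) =>
          (lt - ((-(onormSq i.1.1 / R) : ℝ) : ℂ)) * c i -
          ∑ j : ↥(cubeIdx K), ((am i j : ℝ) : ℂ) * c j + m * vt i,
          ∑ i : ↥(cubeIdx K), conj (vt i) * c i)).1 j‖ ^ 2 +
        ‖m - (X (fun i : ↥(cubeIdx K) =>
          (lt - ((-(onormSq i.1.1 / R) : ℝ) : ℂ)) * c i -
          ∑ j : ↥(cubeIdx K), ((am i j : ℝ) : ℂ) * c j + m * vt i,
          ∑ i : ↥(cubeIdx K), conj (vt i) * c i)).2‖ ^ 2 ≤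
        θ ^ 2 * (∑ j : ↥(cubeIdx K), ‖c j‖ ^ 2 + ‖m‖ ^ 2))
    (hnX : ∀ (c : ↥(cubeIdx K) → ℂ) (g : ℂ),
      ∑ j : ↥(cubeIdx K), ‖(X (c, g)).1 j‖ ^ 2 + ‖(X (c, g)).2‖ ^ 2 ≤
        nX ^ 2 * (∑ j : ↥(cubeIdx K), ‖c j‖ ^ 2 + ‖g‖ ^ 2))
    (hyB : ∀ e : Idx → ℂ,
      ∑ j : ↥(cubeIdx K), ‖(X (fun i : ↥(cubeIdx K) => -∑ j ∈ nbrIdx i \ cubeIdx K,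
          ((am i j : ℝ) : ℂ) * e j, 0)).1 j‖ ^ 2 +
        ‖(X (fun i : ↥(cubeIdx K) => -∑ j ∈ nbrIdx i \ cubeIdx K,
          ((am i j : ℝ) : ℂ) * e j, 0)).2‖ ^ 2 ≤
        yB ^ 2 * ∑ j ∈ (cubeIdx K).biUnion nbrIdx \ cubeIdx K, ‖e j‖ ^ 2)
    (hnB : ∀ e : Idx → ℂ,
      ∑ i : ↥(cubeIdx K), ‖∑ j ∈ nbrIdx i \ cubeIdx K, ((am i j : ℝ) : ℂ) * e j‖ ^ 2 ≤
        nB ^ 2 * ∑ j ∈ (cubeIdx K).biUnion nbrIdx \ cubeIdx K, ‖e j‖ ^ 2)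
    (hyC : ∀ (c : ↥(cubeIdx K) → ℂ) (g : ℂ),
      ∑ i ∈ ((cubeIdx K).biUnion nbrIdx ∪ cubeIdx Kv) \ cubeIdx K,
        ‖∑ j : ↥(cubeIdx K), ((am i j : ℝ) : ℂ) * (X (c, g)).1 j‖ ^ 2 ≤
        yC ^ 2 * (∑ j : ↥(cubeIdx K), ‖c j‖ ^ 2 + ‖g‖ ^ 2))
    (hnC : ∀ z : ↥(cubeIdx K) → ℂ,
      ∑ i ∈ ((cubeIdx K).biUnion nbrIdx ∪ cubeIdx Kv) \ cubeIdx K,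
        ‖∑ j : ↥(cubeIdx K), ((am i j : ℝ) : ℂ) * z j‖ ^ 2 ≤
        nC ^ 2 * ∑ j : ↥(cubeIdx K), ‖z j‖ ^ 2)
    (hxmu : ∀ (c : ↥(cubeIdx K) → ℂ) (g : ℂ),
      ‖(X (c, g)).2‖ ^ 2 ≤ xmu ^ 2 * (∑ j : ↥(cubeIdx K), ‖c j‖ ^ 2 + ‖g‖ ^ 2))
    (hygB : ∀ e : Idx → ℂ,
      ‖(X (fun i : ↥(cubeIdx K) => ∑ j ∈ nbrIdx i \ cubeIdx K,
          ((am i j : ℝ) : ℂ) * e j, 0)).2‖ ^ 2 ≤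
        ygB ^ 2 * ∑ j ∈ (cubeIdx K).biUnion nbrIdx \ cubeIdx K, ‖e j‖ ^ 2)
    (hshellX : ∀ e : Idx → ℂ, (∀ i ∈ cubeIdx K, e i = 0) →
      MU2X * ∑ i ∈ cubeIdx (K + 1) \ cubeIdx K, ‖e i‖ ^ 2 ≤
        ∑ i ∈ cubeIdx (K + 1) \ cubeIdx K, (lt.re - (-(onormSq i.1 / R)) - Real.sqrt 2) * ‖e i‖ ^ 2 -
        RCLike.re (∑ i ∈ (cubeIdx K).biUnion nbrIdx \ cubeIdx K,
          conj (∑ j : ↥(cubeIdx K), ((am i j : ℝ) : ℂ) *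
            (X (fun i : ↥(cubeIdx K) => ∑ j ∈ nbrIdx i \ cubeIdx K,
              ((am i j : ℝ) : ℂ) * e j, 0)).1 j) * e i))
    -- the derived constants, the tail constant and the closing inequalities
    {α δ βB βC gB MU2 μ M : ℝ} (hαdef : α = nX / (1 - θ)) (hδdef : δ = α * θ)
    (hβBdef : βB = yB + nB * δ) (hβCdef : βC = yC + nC * δ + nt * (xmu + δ))
    (hgBdef : gB = ygB + nB * δ) (hMU2def : MU2 = MU2X - nB * nC * δ)
    (htailK : MU2 ≤ lt.re + ((K : ℝ) + 2) ^ 2 / R - Real.sqrt 2)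
    (hμdef : μ = MU2 - gB * nt) (hμ : 0 < μ)
    (hMdef : M = √((1 + βC ^ 2) / μ ^ 2 + (α + βB * √(1 + βC ^ 2) / μ) ^ 2))
    (hκ : 2 * Real.sqrt 2 * M ^ 2 * r₀ < 1) :
    ∃ lam : ℂ, ‖lam - lt‖ ≤ 2 * M * r₀ ∧
      Torus.IsLinNSEigenvalue (1 / (2 * Real.pi * R)) (Torus.abcFlow 1 1 1) (2 * Real.pi * lam) ∧
      (∀ z : ℂ, z ≠ lam → ‖z - lam‖ < (1 - 2 * Real.sqrt 2 * M ^ 2 * r₀) / M →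
        ∀ w : Idx → ℂ, (Summable fun i : Idx => (1 + onormSq i.1 / R) ^ 2 * ‖w i‖ ^ 2) →
          (∀ i : Idx, ((-(onormSq i.1 / R) : ℝ) : ℂ) * w i +
            ∑ j ∈ nbrIdx i, ((am i j : ℝ) : ℂ) * w j = z * w i) → w = 0) ∧
      (lt.im = 0 → 2 * (2 * M * r₀) < (1 - 2 * Real.sqrt 2 * M ^ 2 * r₀) / M → lam.im = 0) ∧
      (∃ w : Idx → ℂ, w ≠ 0 ∧
        (∀ i : Idx, ((-(onormSq i.1 / R) : ℝ) : ℂ) * w i +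
          ∑ j ∈ nbrIdx i, ((am i j : ℝ) : ℂ) * w j = lam * w i) ∧
        ∀ s : ℕ, Summable fun i : Idx => (1 + onormSq i.1) ^ s * ‖w i‖ ^ 2) := by
  classical
  -- the outer shell `nbr(cubeIdx K) ∖ cubeIdx K` sits inside the sup-norm shell and inside `K_ext`
  have hKc : (cubeIdx K).biUnion nbrIdx \ cubeIdx K ⊆
      ((cubeIdx K).biUnion nbrIdx ∪ cubeIdx Kv) \ cubeIdx K :=
    Finset.sdiff_subset_sdiff Finset.subset_union_left le_rfl
  have hKsh : (cubeIdx K).biUnion nbrIdx \ cubeIdx K ⊆ cubeIdx (K + 1) \ cubeIdx K := by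
    intro j hj
    rw [Finset.mem_sdiff, Finset.mem_biUnion] at hj
    obtain ⟨⟨i, hi, hij⟩, hjK⟩ := hj
    refine Finset.mem_sdiff.mpr ⟨mem_cubeIdx.mpr ?_, hjK⟩
    exact (osupNorm_le_of_mem_nbrIdx hij).2.trans (Nat.add_le_add_right (mem_cubeIdx.mp hi) 1)
  have hntc : ∑ i ∈ ((cubeIdx K).biUnion nbrIdx ∪ cubeIdx Kv) \ cubeIdx K, ‖vt i‖ ^ 2 ≤ nt ^ 2 := by
    rw [← Finset.sum_subset (Finset.sdiff_subset_sdiff Finset.subset_union_right le_rfl)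
      (fun i hi hi' => by
        rw [Finset.mem_sdiff] at hi hi'
        have : i ∉ cubeIdx Kv := fun h => hi' ⟨h, hi.2⟩
        rw [hvt0 i this, norm_zero, zero_pow two_ne_zero])]
    exact hntb
  obtain ⟨Binv, hBinv, hαM, hβBM, hβCM, hgBM, hshellM⟩ :=
    BorderedEigenpairApproxInverse.exists_borderedInverse_of_approx (cubeIdx K) nbrIdx
      (((cubeIdx K).biUnion nbrIdx ∪ cubeIdx Kv) \ cubeIdx K) (cubeIdx (K + 1) \ cubeIdx K) hKc hKsh
      (fun i j => ((am i j : ℝ) : ℂ)) (fun i => lt - ((-(onormSq i.1 / R) : ℝ) : ℂ)) vt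
      (fun i => lt.re - (-(onormSq i.1 / R)) - Real.sqrt 2) X hθ0 hθ1 hnX0 hyB0 hnB0 hyC0 hnC0
      hxmu0 hygB0 hnt hθ hnX hyB hnB hyC hnC hxmu hygB hntc hshellX hαdef hδdef hβBdef hβCdef
      hgBdef hMU2def
  have hα : 0 ≤ α := by rw [hαdef]; exact div_nonneg hnX0 (by linarith)
  have hδ : 0 ≤ δ := by rw [hδdef]; positivity
  have hβB : 0 ≤ βB := by rw [hβBdef]; positivity
  have hβC : 0 ≤ βC := by rw [hβCdef]; positivity
  have hgB : 0 ≤ gB := by rw [hgBdef]; positivity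
  exact isLinNSEigenvalue_near_of_nested_certificate_of_bases e bf hbf am ham hR K Kv lt vt hvt0 hr₀ hnt
    hres hntb Binv hBinv hα hβB hβC hgB hαM hβBM hβCM hgBM hshellM htailK hμdef hμ hMdef hκ

end OfBases

end Summit.NavierStokesRegularity.FluidComputer.AbcClassIIEigenpair

end
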